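/-
Copyright (c) 2026 the pub-hodgecm-mathlib formalisation cell (harness21).  Prover seat hodgecm-mathlib-K2E5-p16 (g6), Track B «K2-LIT»,
#184♮ = hLiu418 = `stmt-HodgeConjecture-24832`; RULING «M-158g» (S2-asm road (γ), (J-iii)): MULTI-PLACE INJECTIVITY `K2LiuArchCompactPictureInjective` —
two arch Siegel sections with the same law and the same values on the product compact `Π_w Kw w` (the multi-place compact picture) ARE EQUAL.
THEOREMS ONLY (no `def`, no `instance`, no notation, no `sorry`); hypothesis-first currency of ★ 2c-inst `K2LiuArchCompactPicturePlaceTensor` (`Kw`, `hk2`).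
-/
import Summits.HodgeConjecture.HodgeConjecture.Theorems.K2LiuArchCompactPicturePlaceTensor   -- ★ 2c-inst letters (`archPiEquivCM`, `IsArchSiegelDeltaSection`, …)
import HarnessLib

/-!
# Crux `HLiu418`, S2-asm (γ): multi-place injectivity of the compact picture

Cell `hodgecm-mathlib`, crux item hLiu418 = `stmt-HodgeConjecture-24832` (helper lane `--supports`, count-neutral).

* §1 GENERIC (finite product of groups `Π i, G i`, slices `Pi.mulSingle i`): **`eq_of_sliceLaw_of_eq_on_prod`** — if `B, B′ : (Π i, G i) → ℂ` obey the
  same slice law `B (Pi.mulSingle i p · g) = c i p · B g` for `p ∈ P i`, every slice decomposes `G i = P i · K i`, and `B = B′` on `Π i, K i`, then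
  `B = B′` (peel the places one at a time: overwrite the `K`-part slot by slot);
* §2 INSTANCE at the arch group of the doubled CM datum (★ `archPiEquivCM`, ★ `IsArchSiegelDeltaSection`, the one-place Siegel law through
  ★ `siegelDeltaCharacter ∘ archToAdelic ∘ ι_w`, per-place Iwasawa `hk2` as in ★ `exists_sum_prod_archPlaces`):
  **`eq_of_isArchSiegelDeltaSection_of_eq_on_prodK`** — two lawful arch sections agreeing on `archPiEquivCM⁻¹ (Π_w Kw w)` are equal.
This is the «frame-independence ∕ `A = Σ_T AT T` by multi-place injectivity» step of RULING M-158g (J-iii) (K2Liu-p05 (g5)'s FILE 3).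
References: [BorelJacquet1979, §4.1]; [Knapp1986, Ch. VII §1 (compact picture)]; [Tan1999, §1].
HONEST LABEL: HC_CM is proved only modulo the 7 printed citations (2 remaining named inputs: hLiu418 = stmt-HodgeConjecture-24832,
h413 = stmt-HodgeConjecture-24833) until rung 0 closes; count-neutral helper, closes no socket.
-/

set_option autoImplicit false
set_option linter.dupNamespace false

noncomputable section

open scoped Matrix Classical
open NumberField IsDedekindDomain
open Literature.NumberTheory.Automorphic Literature.NumberTheory.Automorphic.UnitaryGroup Literature.NumberTheory.GaloisRepresentations
open Literature.NumberTheory.GelbartRogawski1991 Literature.NumberTheory.GelbartRogawski1991.GRConstruction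
open Literature.NumberTheory.GelbartRogawski1991.UnitaryDualPair
open Literature.NumberTheory.K2Lit.SiegelDoubled Literature.NumberTheory.K2Lit.LocalSiegelDoubled
open Summit.HodgeConjecture.HodgeConjecture.Cruxes.HLiu418.K2LiuArchSWSpanningDefs

namespace Summit.HodgeConjecture.HodgeConjecture.Cruxes.HLiu418.K2LiuArchCompactPictureInjective

/-! ## §1  Generic: peeling the places of a finite product -/

section Generic

variable {ι : Type} [Fintype ι] [DecidableEq ι] {G : ι → Type} [∀ i, Group (G i)]

omit [Fintype ι] in
/-- **PEELING LEMMA**: with the slice law on every place and `pvec i ∈ P i` for all `i`,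
`B (fun i => if i ∈ s then pvec i * y i else x i)·…` — stated as: for every finset `s`, overwriting the slots in `s` of `x` by `pvec i * y i` multiplies
`B` of the `y`-overwrite by `∏_{i ∈ s} c i (pvec i)`. [folklore] -/
theorem apply_overwrite_eq_prod_mul (P : ∀ i, Set (G i)) (c : ∀ i, G i → ℂ) {B : (Π i, G i) → ℂ}
    (hB : ∀ i, ∀ p ∈ P i, ∀ g, B (Pi.mulSingle i p * g) = c i p * B g) (pvec y : Π i, G i) (hp : ∀ i, pvec i ∈ P i) (s : Finset ι)
    (x : Π i, G i) :
    B (fun i => if i ∈ s then pvec i * y i else x i) = (∏ i ∈ s, c i (pvec i)) * B (fun i => if i ∈ s then y i else x i) := by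
  induction s using Finset.induction_on generalizing x with
  | empty => simp
  | @insert a s ha ih =>
    have h1 : (fun i => if i ∈ insert a s then pvec i * y i else x i) =
        Pi.mulSingle a (pvec a) * fun i => if i ∈ s then pvec i * y i else (if i = a then y i else x i) := by
      funext i
      by_cases h : i = a
      · subst h; simp [ha]
      · simp [h]
    have h3 : (fun i => if i ∈ insert a s then y i else x i) = fun i => if i ∈ s then y i else (if i = a then y i else x i) := by
      funext i
      by_cases h : i = a
      · subst h; simp [ha]
      · simp [h]
    rw [h1, hB a (pvec a) (hp a), ih (fun j => if j = a then y j else x j), h3, Finset.prod_insert ha, mul_assoc]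

/-- **GENERIC MULTI-PLACE INJECTIVITY**: same slice law on every place, every slice `G i = P i · K i`, equality on `Π i, K i` ⇒ equality.
[cite: Knapp1986, Ch. VII §1] -/
theorem eq_of_sliceLaw_of_eq_on_prod (P K : ∀ i, Set (G i)) (c : ∀ i, G i → ℂ) {B B' : (Π i, G i) → ℂ}
    (hB : ∀ i, ∀ p ∈ P i, ∀ g, B (Pi.mulSingle i p * g) = c i p * B g)
    (hB' : ∀ i, ∀ p ∈ P i, ∀ g, B' (Pi.mulSingle i p * g) = c i p * B' g)
    (hI : ∀ i (x : G i), ∃ p ∈ P i, ∃ k ∈ K i, x = p * k)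
    (hK : ∀ k : Π i, G i, (∀ i, k i ∈ K i) → B k = B' k) : B = B' := by
  funext x
  choose pvec hp kvec hk hx using fun i => hI i (x i)
  have hxs : x = fun i => if i ∈ (Finset.univ : Finset ι) then pvec i * kvec i else x i := by
    funext i; simp [hx i]
  have hks : (fun i => if i ∈ (Finset.univ : Finset ι) then kvec i else x i) = kvec := by
    funext i; simp
  rw [hxs, apply_overwrite_eq_prod_mul P c hB pvec kvec hp _ x, apply_overwrite_eq_prod_mul P c hB' pvec kvec hp _ x, hks, hK kvec hk]

end Generic

/-! ## §2  The arch group of the doubled CM datum -/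

variable (L : Type) [Field L] [NumberField L] [IsCMField L]
variable {N M n : ℕ} (e : Fin N × Fin M ≃ Fin n)
  (dV : Fin N → L) (hdV : ∀ i, IsCMField.complexConj L (dV i) = dV i)
  (dW : Fin M → L) (hdW : ∀ i, IsCMField.complexConj L (dW i) = dW i)

/-- **MULTI-PLACE INJECTIVITY OF THE COMPACT PICTURE**: two arch Siegel sections `A, A′ ∈ I_∞(s, χ)` (★ `IsArchSiegelDeltaSection`) which agree on
`archPiEquivCM⁻¹ (Π_w Kw w)` — for per-place compacts `Kw w` with the per-place Iwasawa decomposition `hk2` (★ 2c-inst currency) — are EQUAL.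
[cite: Knapp1986, Ch. VII §1] [cite: BorelJacquet1979, §4.1] [cite: Tan1999, §1] -/
theorem eq_of_isArchSiegelDeltaSection_of_eq_on_prodK (χ : HeckeCharacter L) (s : ℂ)
    {A A' : UnitaryGroup.arch (Fp L) L (IsCMField.complexConj L) (n + n) (hermD L e dV hdV dW hdW) → ℂ}
    (hA : IsArchSiegelDeltaSection L e dV hdV dW hdW χ s A) (hA' : IsArchSiegelDeltaSection L e dV hdV dW hdW χ s A')
    (Kw : ∀ w : {w : InfinitePlace L // w.IsComplex}, Set (UnitaryGroup.archLocal L (n + n) (hermD L e dV hdV dW hdW) w))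
    (hk2 : ∀ (w : {w : InfinitePlace L // w.IsComplex}) (g : UnitaryGroup.archLocal L (n + n) (hermD L e dV hdV dW hdW) w),
      ∃ p : UnitaryGroup.archLocal L (n + n) (hermD L e dV hdV dW hdW) w,
        IsSiegelDelta L e dV hdV dW hdW (UnitaryGroup.archToAdelic (Fp L) L (IsCMField.complexConj L) (n + n) (hermD L e dV hdV dW hdW)
          ((UnitaryGroup.archPiEquivCM (n + n) L (hermD L e dV hdV dW hdW)).symm (Pi.mulSingle w p))) ∧ ∃ k ∈ Kw w, g = p * k)
    (hK : ∀ k : ∀ w : {w : InfinitePlace L // w.IsComplex}, UnitaryGroup.archLocal L (n + n) (hermD L e dV hdV dW hdW) w, (∀ w, k w ∈ Kw w) →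
      A ((UnitaryGroup.archPiEquivCM (n + n) L (hermD L e dV hdV dW hdW)).symm k) =
        A' ((UnitaryGroup.archPiEquivCM (n + n) L (hermD L e dV hdV dW hdW)).symm k)) :
    A = A' := by
  have key : (fun g => A ((UnitaryGroup.archPiEquivCM (n + n) L (hermD L e dV hdV dW hdW)).symm g)) =
      fun g => A' ((UnitaryGroup.archPiEquivCM (n + n) L (hermD L e dV hdV dW hdW)).symm g) :=
    eq_of_sliceLaw_of_eq_on_prod
      (fun w => {p | IsSiegelDelta L e dV hdV dW hdW
        (UnitaryGroup.archToAdelic (Fp L) L (IsCMField.complexConj L) (n + n) (hermD L e dV hdV dW hdW)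
          ((UnitaryGroup.archPiEquivCM (n + n) L (hermD L e dV hdV dW hdW)).symm (Pi.mulSingle w p)))})
      Kw (fun w p => siegelDeltaCharacter L e dV hdV dW hdW χ s
        (UnitaryGroup.archToAdelic (Fp L) L (IsCMField.complexConj L) (n + n) (hermD L e dV hdV dW hdW)
          ((UnitaryGroup.archPiEquivCM (n + n) L (hermD L e dV hdV dW hdW)).symm (Pi.mulSingle w p))))
      (fun w p hp g => by
        simp only [map_mul]
        exact hA _ hp _)
      (fun w p hp g => by
        simp only [map_mul]
        exact hA' _ hp _)
      (fun w x => hk2 w x) hK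
  funext a
  have h := congrFun key (UnitaryGroup.archPiEquivCM (n + n) L (hermD L e dV hdV dW hdW) a)
  simp only [ContinuousMulEquiv.symm_apply_apply] at h
  exact h

end Summit.HodgeConjecture.HodgeConjecture.Cruxes.HLiu418.K2LiuArchCompactPictureInjective

end
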